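import Mathlib
import HarnessLib
import Literature.AlgebraicGeometry.Resolution.AugmentationIdeal
import Literature.AlgebraicGeometry.Resolution.RegularQuotientIdeal
import Literature.AlgebraicGeometry.Resolution.RsopMonomialIdeals
import Literature.RingTheory.CompleteLocalRings.TameAutomorphismCotangent
import Summits.ResolutionOfSingularities.ResolutionOfSingularities.Theorems.WildQuotientsWildQuotientResolutionTameFixedLocus

/-!
# Tame fixed loci have normal crossings with a stable boundary, in every dimension
# (crux `WildQuotients.WildQuotientResolution`, stub `stub_phaseZeroHighDim`: permissibility of tame centres WITH boundary)

Crux stmt-ResolutionOfSingularities-15640 (`WildQuotientResolution`), registered stub `stub_phaseZeroHighDim`.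
✓`TameFixedLocus` (p817669): on a regular local ring `(R, 𝔪, κ)` the fixed-locus ideal `𝔞 = ⨆ g, I_{τ g}` of a
finite group of invertible order fixing the closed point is cut out by a part of a regular system of parameters.
A Phase-0 move must moreover keep the exceptional boundary a strict normal crossings divisor, i.e. the centre
`V(𝔞)` must have NORMAL CROSSINGS with the boundary divisors `E_i = V(z_i)` through the point (each of them
stable under the group). This file proves the classical dichotomy behind that (linearly reductive case,
here: finite of invertible order), in every dimension:

* `mem_augIdeal_of_apply_eq_mul` — if `τ h z = u z` with `u − 1` a unit (the character of `h` on the conormal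
  line of `E = V(z)` is NON-TRIVIAL), then `z ∈ I_{τ h} ⊆ 𝔞`: the fixed locus lies INSIDE `E`;
* `exists_isRsopPart_append` — if the boundary equations `z_1, …, z_r` (cotangent-independent, i.e. SNC) are
  fixed TO FIRST ORDER by the group (`τ g z_i − z_i ∈ 𝔪²`: trivial characters), then `𝔞 = (f_1, …, f_c)` with
  `(f_1, …, f_c, z_1, …, z_r)` TOGETHER part of a regular system of parameters: the fixed locus is
  TRANSVERSAL to the boundary stratum, `V(𝔞) ∩ ⋂ E_i` regular of the expected codimension.
  Proof: the trace `tr = ∑ g, τ g` maps `𝔞` into `𝔪²` (✓`sum_apply_mem_mul_of_mem_span`) and is `≡ |I| ·`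
  on first-order invariants modulo `𝔪²`; applying `tr` to a relation `∑ a_j f_j + ∑ b_i z_i ∈ 𝔪²` kills the
  `f`-part, so `∑ b_i z_i ∈ 𝔪²`, whence all `b_i ∈ 𝔪` (SNC) and then all `a_j ∈ 𝔪` (independence of the `f_j`).

In a tame toroidalisation both cases keep the boundary SNC after blowing up `V(𝔞)` (mixed characters: split the
boundary components by their character — the non-trivial ones contain the centre, the trivial ones are transversal).

[OURS · crux stmt-ResolutionOfSingularities-15640 · helper toward `stub_phaseZeroHighDim` (NOT a proof of the
stub); classical (Fogarty / Iversen; cf. Conrad–Gabber–Prasad A.8.10), counted 0; AI-level work, weaker than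
expert review.] [folklore]
-/

-- single-problem summit: the doubled namespace component `ResolutionOfSingularities` is forced
set_option linter.dupNamespace false

noncomputable section

namespace Summit.ResolutionOfSingularities.ResolutionOfSingularities.Theorems.WildQuotientResolution.TameFixedLocus

open IsLocalRing
open Literature.AlgebraicGeometry.Resolution Literature.RingTheory.CompleteLocalRings

universe u

/-! ## Non-trivial character: the fixed locus lies in the divisor -/

section NonTrivial

variable {R : Type*} [CommRing R]

/-- **Non-trivial character ⇒ `Fix ⊆ E`**: if an automorphism `σ` multiplies `z` by `u` with `u − 1` a unit
(e.g. `σ` acts on the conormal line of the `σ`-stable divisor `V(z)` of a local ring by a residue class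
`≠ 1`), then `z = (u − 1)⁻¹ (σ z − z)` lies in the fixed-locus ideal `I_σ`. [folklore] -/
theorem mem_augIdeal_of_apply_eq_mul (σ : R ≃+* R) {z u : R} (hz : σ z = u * z) (hu : IsUnit (u - 1)) :
    z ∈ augIdeal σ := by
  obtain ⟨v, hv⟩ := hu.exists_left_inv
  have e : z = v * (σ z - z) := by
    rw [hz, show u * z - z = (u - 1) * z by ring, ← mul_assoc, hv, one_mul]
  rw [e]
  exact Ideal.mul_mem_left _ _ (sub_mem_augIdeal σ z)

/-- The same for a member `τ h` of a group action: `z ∈ ⨆ g, I_{τ g}`. [folklore] -/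
theorem mem_iSup_augIdeal_of_apply_eq_mul {I : Type*} [Group I] (τ : I →* (R ≃+* R)) (h : I)
    {z u : R} (hz : τ h z = u * z) (hu : IsUnit (u - 1)) : z ∈ ⨆ g, augIdeal (τ g) :=
  Submodule.mem_iSup_of_mem h (mem_augIdeal_of_apply_eq_mul (τ h) hz hu)

end NonTrivial

/-! ## Trivial characters: the fixed locus is transversal to the boundary -/

section Trivial

variable {R : Type*} [CommRing R] [IsLocalRing R] {I : Type*} [Group I] [Fintype I]
  (τ : I →* (R ≃+* R))

/-- The trace maps the fixed-locus ideal into `𝔪²` (closed point fixed, order invertible):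
`tr(𝔞) ⊆ 𝔪 · 𝔞 ⊆ 𝔪²`. [folklore] -/
theorem sum_apply_mem_sq_of_mem_iSup (hm : (⨆ g, augIdeal (τ g)) ≤ maximalIdeal R)
    {u : R} (hu : u * (Fintype.card I : R) = 1) {x : R} (hx : x ∈ ⨆ g, augIdeal (τ g)) :
    ∑ g, τ g x ∈ maximalIdeal R ^ 2 := by
  rw [iSup_augIdeal_eq_span τ hu] at hx
  have h := sum_apply_mem_mul_of_mem_span τ hm hu (s := {y : R | ∑ g, τ g y = 0}) (fun _ hf => hf) hx
  rw [pow_two]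
  exact Ideal.mul_mono_right hm h

/-- For `z ∈ 𝔪` fixed to first order (`τ g z − z ∈ 𝔪²` for all `g`) and any `b`,
`tr(b z) − |I| · b z ∈ 𝔪²` (`τ(b) τ(z) − b z = (τ b − b) τ z + b (τ z − z)`). [folklore] -/
theorem sum_apply_mul_sub_mem_sq (hm : (⨆ g, augIdeal (τ g)) ≤ maximalIdeal R) {z : R}
    (hz : z ∈ maximalIdeal R) (hzinv : ∀ g, τ g z - z ∈ maximalIdeal R ^ 2) (b : R) :
    ∑ g, τ g (b * z) - (Fintype.card I : R) * (b * z) ∈ maximalIdeal R ^ 2 := by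
  have e : ∑ g, τ g (b * z) - (Fintype.card I : R) * (b * z) =
      ∑ g, ((τ g b - b) * τ g z + b * (τ g z - z)) := by
    rw [← Finset.card_univ, ← nsmul_eq_mul, ← Finset.sum_const, ← Finset.sum_sub_distrib]
    exact Finset.sum_congr rfl fun g _ => by rw [map_mul]; ring
  rw [e]
  refine Ideal.sum_mem _ fun g _ => add_mem ?_ (Ideal.mul_mem_left _ _ (hzinv g))
  rw [pow_two]
  exact Ideal.mul_mem_mul (hm (Submodule.mem_iSup_of_mem g (sub_mem_augIdeal (τ g) b)))
    (apply_mem_maximalIdeal τ hm g hz)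

end Trivial

section Regular

variable {R : Type u} [CommRing R] [IsRegularLocalRing R] {I : Type*} [Group I] [Finite I]
  (τ : I →* (R ≃+* R))

/-- **Tame fixed loci are transversal to a first-order-fixed SNC boundary** (crux
stmt-ResolutionOfSingularities-15640, toward `stub_phaseZeroHighDim`; any dimension). Let `(R, 𝔪, κ)` be regular
local, `I` finite of invertible order acting by `τ` and fixing the closed point, and `z_1, …, z_r ∈ 𝔪` with
linearly independent images in `𝔪/𝔪²` (an SNC boundary through the point) such that `τ g z_i − z_i ∈ 𝔪²` for
all `g, i`. Then there are `f_1, …, f_c` with `(f) = ⨆ g, I_{τ g}` such that `(f_1, …, f_c, z_1, …, z_r)` is part of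
ONE regular system of parameters. [folklore] -/
theorem exists_isRsopPart_append (hI : IsUnit ((Nat.card I : ℕ) : R))
    (hm : (⨆ g, augIdeal (τ g)) ≤ maximalIdeal R) {r : ℕ} (z : Fin r → R)
    (hz : ∀ i, z i ∈ maximalIdeal R)
    (hzli : LinearIndependent (ResidueField R) fun i => (maximalIdeal R).toCotangent ⟨z i, hz i⟩)
    (hzinv : ∀ (g : I) (i : Fin r), τ g (z i) - z i ∈ maximalIdeal R ^ 2) :
    ∃ (c : ℕ) (f : Fin c → R), Ideal.span (Set.range f) = (⨆ g, augIdeal (τ g)) ∧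
      IsRsopPart (Fin.append f z) := by
  classical
  have : Fintype I := Fintype.ofFinite I
  obtain ⟨u, hu⟩ := hI.exists_left_inv
  rw [Nat.card_eq_fintype_card] at hu
  set m := maximalIdeal R with hmdef
  obtain ⟨c, f, hf, hfJ, hspan, hfli⟩ := exists_generators_linearIndependent τ hI hm
  have hfind := (linearIndependent_toCotangent_iff_forall_mem f hf).mp hfli
  have hzind := (linearIndependent_toCotangent_iff_forall_mem z hz).mp hzli
  -- membership of the appended family in `𝔪`
  have hw : ∀ i, Fin.append f z i ∈ m := by
    intro i
    induction i using Fin.addCases with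
    | left j => rw [Fin.append_left]; exact hf j
    | right k => rw [Fin.append_right]; exact hz k
  -- the coefficient form of cotangent independence for the appended family
  have hind : ∀ a : Fin (c + r) → R, ∑ i, a i * Fin.append f z i ∈ m ^ 2 → ∀ i, a i ∈ m := by
    intro a ha
    rw [Fin.sum_univ_add] at ha
    simp only [Fin.append_left, Fin.append_right] at ha
    set A := ∑ j : Fin c, a (Fin.castAdd r j) * f j with hA
    set B := ∑ k : Fin r, a (Fin.natAdd c k) * z k with hB
    -- `A ∈ 𝔞`, so `tr A ∈ 𝔪²`
    have hAJ : A ∈ ⨆ g, augIdeal (τ g) :=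
      Ideal.sum_mem _ fun j _ => Ideal.mul_mem_left _ _ (hfJ j)
    have htrA : ∑ g, τ g A ∈ m ^ 2 := sum_apply_mem_sq_of_mem_iSup τ hm hu hAJ
    -- `tr B − |I| B ∈ 𝔪²`
    have htrB : ∑ g, τ g B - (Fintype.card I : R) * B ∈ m ^ 2 := by
      have e : ∑ g, τ g B - (Fintype.card I : R) * B =
          ∑ k : Fin r, (∑ g, τ g (a (Fin.natAdd c k) * z k) -
            (Fintype.card I : R) * (a (Fin.natAdd c k) * z k)) := by
        rw [Finset.sum_sub_distrib, ← Finset.mul_sum, ← hB]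
        congr 1
        rw [hB]
        simp_rw [map_sum]
        rw [Finset.sum_comm]
      rw [e]
      exact Ideal.sum_mem _ fun k _ => sum_apply_mul_sub_mem_sq τ hm (hz k) (fun g => hzinv g k) _
    -- `tr (A + B) ∈ 𝔪²`
    have htr : ∑ g, τ g (A + B) ∈ m ^ 2 := by
      refine Ideal.sum_mem _ fun g _ => ?_
      exact map_maximalIdeal_pow_le (τ g) 2 (Ideal.mem_map_of_mem _ ha)
    -- hence `|I| B ∈ 𝔪²` and `B ∈ 𝔪²`
    have hnB : (Fintype.card I : R) * B ∈ m ^ 2 := by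
      have e : (Fintype.card I : R) * B = ∑ g, τ g (A + B) - ∑ g, τ g A -
          (∑ g, τ g B - (Fintype.card I : R) * B) := by
        simp_rw [map_add]
        rw [Finset.sum_add_distrib]
        ring
      rw [e]
      exact sub_mem (sub_mem htr htrA) htrB
    have hB2 : B ∈ m ^ 2 := by
      have e : B = u * ((Fintype.card I : R) * B) := by rw [← mul_assoc, hu, one_mul]
      rw [e]
      exact Ideal.mul_mem_left _ _ hnB
    have hbz : ∀ k : Fin r, a (Fin.natAdd c k) ∈ m := hzind (fun k => a (Fin.natAdd c k)) hB2
    have hA2 : A ∈ m ^ 2 := by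
      have e : A = (A + B) - B := by ring
      rw [e]
      exact sub_mem ha hB2
    have haf : ∀ j : Fin c, a (Fin.castAdd r j) ∈ m := hfind (fun j => a (Fin.castAdd r j)) hA2
    intro i
    induction i using Fin.addCases with
    | left j => exact haf j
    | right k => exact hbz k
  obtain ⟨e, y, hdim, hsp⟩ := exists_extend_to_rsop (Fin.append f z) hw hind
  exact ⟨c, f, hspan, ‹IsRegularLocalRing R›, e, y, hdim, hsp⟩

/-- **Corollary: the fixed locus meets the boundary stratum transversally** — with the data of
`exists_isRsopPart_append`, `R ⧸ ((⨆ g, I_{τ g}) + (z_1, …, z_r))` is a regular local ring. [folklore] -/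
theorem isRegularLocalRing_quotient_iSup_augIdeal_sup_span (hI : IsUnit ((Nat.card I : ℕ) : R))
    (hm : (⨆ g, augIdeal (τ g)) ≤ maximalIdeal R) {r : ℕ} (z : Fin r → R)
    (hz : ∀ i, z i ∈ maximalIdeal R)
    (hzli : LinearIndependent (ResidueField R) fun i => (maximalIdeal R).toCotangent ⟨z i, hz i⟩)
    (hzinv : ∀ (g : I) (i : Fin r), τ g (z i) - z i ∈ maximalIdeal R ^ 2) :
    IsRegularLocalRing (R ⧸ (⨆ g, augIdeal (τ g)) ⊔ Ideal.span (Set.range z)) := by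
  obtain ⟨c, f, hspan, hrsop⟩ := exists_isRsopPart_append τ hI hm z hz hzli hzinv
  have hr : Set.range (Fin.append f z) = Set.range f ∪ Set.range z := by
    ext a
    constructor
    · rintro ⟨i, rfl⟩
      induction i using Fin.addCases with
      | left j => exact Or.inl ⟨j, by simp⟩
      | right k => exact Or.inr ⟨k, by simp⟩
    · rintro (⟨j, rfl⟩ | ⟨k, rfl⟩)
      · exact ⟨Fin.castAdd r j, by simp⟩
      · exact ⟨Fin.natAdd c k, by simp⟩
  have h := hrsop.isRegularLocalRing_quotient
  rw [hr, Ideal.span_union, hspan] at h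
  exact h

end Regular

end Summit.ResolutionOfSingularities.ResolutionOfSingularities.Theorems.WildQuotientResolution.TameFixedLocus

end
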